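import Summits.QuantumFields.BalabanUV.T4Continuum.Support.NE7EnergyBlockLandauPoincare
import Summits.QuantumFields.BalabanUV.T4Continuum.Support.NE3CovariantLineSumsTower
import Summits.QuantumFields.BalabanUV.T4Continuum.Support.NE7CornerSpikeTopDictionary
import Summits.QuantumFields.BalabanUV.T4Continuum.Support.PeriodicChoice
import HarnessLib

/-!
# NE7SliceSplitUnique — THE LINEAR SLICE SPLIT `T = Ỹ + gaugeDir W ζ`, `Ỹ ∈ 𝒯_E(W)`, IS UNIQUE ONCE THE NESTED MEAN OF `ζ` IS FIXED, hence ADDITIVE (memo ROAD-G100 §2.2∕§2.4: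
# the split is a well-defined LINEAR map of `(T, h)` — what makes the defect `δ(u)` a function of the state and gives `split(T(step u)) = (Ỹ(u), 0) + split(error, j_c)`)

Cell `pub-balaban`, rung (B)+1 sub-cell t4, lineage `b2b-balaban-t4-ne7-p1`, generation 100 (CRUX PROVER NE7 #1 = OWNER of BINDER row NE7).  Memo `t4/b2b-balaban-t4-ne7-p1-g100/ROAD-G100.md` §2:
the supplier (S1) splits the current tangent part `T(u)` as `Ỹ(u) + gaugeDir W ζ(u)` (`NE7SliceGaugeFunctionSized.exists_fullGauge_split_sized`: `Ỹ ∈ 𝒯_E(W)`, nested mean of `ζ` EXACTLY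
`−(framePotW T − h)`); the one-step identities (§2.2: `T(step u) = Ỹ(u) + E`, new datum `j_c`) are read through LINEARITY of the split, which is THIS FILE: two splits of the same `T` whose gauge
functions have the same nested mean coincide (`Ỹ = Ỹ′`, `gaugeDir W ζ = gaugeDir W ζ′`: the difference of the gauge functions lies in `Ξ_Q(W)`, and `Ỹ − Ỹ′ = gaugeDir W(ζ′ − ζ)` is
`hsR`-orthogonal to itself), so splits ADD and a slice element with datum its own frame splits trivially.
WHAT ([folklore]; 0 def, 0 sorry).
§1 `mem_energyBlockLandauW_add` (class: `𝒯_E(W)` is closed under addition), `zero_mem_energyBlockLandauW`.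
§2 **`slice_split_unique`** (`W` unitary `(tower L N (j+1))`-periodic): `T = Ỹ + gaugeDir W ζ = Ỹ′ + gaugeDir W ζ′`, `Ỹ, Ỹ′ ∈ 𝒯_E(W)`, `ζ, ζ′` skew periodic with
   `bmeanIterW ζ = bmeanIterW ζ′` ⟹ `Ỹ = Ỹ′` and `gaugeDir W ζ = gaugeDir W ζ′` pointwise.
§3 **`slice_split_add`** (class): splits of `T₁`, `T₂` and of `T₁ + T₂` with `bmeanIterW ζ = bmeanIterW ζ₁ + bmeanIterW ζ₂` ⟹ `Ỹ = Ỹ₁ + Ỹ₂`, `gaugeDir W ζ = gaugeDir W ζ₁ + gaugeDir W ζ₂`;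
   `slice_split_of_mem` (a slice element splits as itself: `Ỹ = Y′ + gaugeDir W ζ`, `Y′ ∈ 𝒯_E`, `bmeanIterW ζ = 0` ⟹ `Y′ = Ỹ`, `gaugeDir W ζ = 0`).
HONEST FRAMING (page 1): finite-dimensional linear algebra at ONE background; nothing of Bałaban's asserted; NOT (L), NOT (S1), NOT NE7; spine 0∕9; finite T⁴ rung (B)+1 — NOT infinite volume,
NOT mass gap, NOT BetaPertH, NOT Clay.  Continuum YM on T⁴ ⇐ BetaPertH ∧ nine spine estimates (0/9 proved); BetaPertH ⇐ (D1) ∧ (D4) ∧ CAP+tail; G-an2-4 gates asym, D1 and NE2/3/4.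
-/

set_option autoImplicit false

open scoped BigOperators Matrix.Norms.L2Operator
open Finset

namespace Summit.QuantumFields.BalabanUV.T4Continuum.NE7SliceSplitUnique

open Literature.MathematicalPhysics.QuantumFieldTheory.Balaban1983to89
open B7Prop1Explicit B7Prop2Explicit
open T4AveragingDeficitWall (IsUnitaryCfg IsSkewDir SmallField Ad)
open T4AveragingDeficitWallBoundary (IsPeriodicCfg periodBox)
open AveragingDeficitPeriodicCounting (IsPeriodicDir)
open AveragingDeficitMultiLevelPrep (LevelSmall tower)
open BlockAveragePushDirGauge (gaugeDir isPeriodicDir_gaugeDir)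
open NE3TangentCovariantTower (QbarIter)
open NE3TangentCovariantStructure (gaugeDir_add_fun)
open NE3CovariantCalculus (hsR hsR_add_left hsR_sub_left hsR_self)
open NE3CovariantLineSumsTower (QbarIter_add)
open NE3CovariantBlockMean (bmeanIterW)
open NE3FrameFreeSliceW (bmeanIterW_add bmeanIterW_zero')
open NE3LandauOrbit (eq_zero_of_nhsNormSq_eq_zero hsR_zero_left)
open MatrixNorms (nhsNormSq nhsNormSq_nonneg)
open NE7EnergyBlockLandauPoincare (bmeanIterW_sub)
open NE7MeanZeroGaugeSliceW (energyBlockLandauW meanZeroGaugeSpaceW mem_meanZeroGaugeSpaceW_iff)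
open NE7CornerSpikeTopDictionary (gaugeDir_sub_fun)
open NE3SmoothLiftW (gaugeDir_zero_fun)
open PeriodicChoice (apply_wrap_eq wrap_mem_periodBox)

noncomputable section

variable {d : ℕ} {n : Type*} [Fintype n] [DecidableEq n]

/-! ## §1 `𝒯_E(W)` is closed under addition -/

/-- **`𝒯_E(W)` IS CLOSED UNDER ADDITION** (multi-level small-field class at level `j+1`, for the linearity of `Q̄`). [folklore] -/
theorem mem_energyBlockLandauW_add [Nonempty n] {L N : ℕ} (hL : 1 ≤ L) (j : ℕ) {W : Site d → Fin d → (Matrix n n ℂ)ˣ} {x : ℝ}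
    (hWu : IsUnitaryCfg W) (hx : 0 ≤ x) (hs : LevelSmall d L j x) (hWx : SmallField W x)
    {X X' : Site d → Fin d → Matrix n n ℂ} (hX : X ∈ energyBlockLandauW (d := d) (n := n) L N (j + 1) W)
    (hX' : X' ∈ energyBlockLandauW (d := d) (n := n) L N (j + 1) W) :
    (fun y μ => X y μ + X' y μ) ∈ energyBlockLandauW (d := d) (n := n) L N (j + 1) W := by
  obtain ⟨hXs, hXP, hXQ, hXo⟩ := hX
  obtain ⟨hX's, hX'P, hX'Q, hX'o⟩ := hX'
  refine ⟨fun y μ => (skewAdjoint _).add_mem (hXs y μ) (hX's y μ), fun y i μ => by simp only [hXP y i μ, hX'P y i μ], ?_, fun ζ hζ => ?_⟩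
  · rw [QbarIter_add hL j hWu hx hs hWx, hXQ, hX'Q]
    funext z κ; simp
  · simp_rw [hsR_add_left, Finset.sum_add_distrib, hXo ζ hζ, hX'o ζ hζ, add_zero]

/-- `0 ∈ 𝒯_E(W)` (any `W`, any level). [folklore] -/
theorem zero_mem_energyBlockLandauW {L N k : ℕ} {W : Site d → Fin d → (Matrix n n ℂ)ˣ} (hQ0 : QbarIter L k W (fun _ _ => (0 : Matrix n n ℂ)) = 0) :
    (fun _ _ => (0 : Matrix n n ℂ)) ∈ energyBlockLandauW (d := d) (n := n) L N k W :=
  ⟨fun _ _ => (skewAdjoint _).zero_mem, fun _ _ _ => rfl, hQ0, fun ζ _ => by simp [hsR_zero_left]⟩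

/-! ## §2 Uniqueness of the split with prescribed nested mean -/

/-- **UNIQUENESS OF THE SLICE SPLIT** (`W` unitary of period `tower L N (j+1)`): if `T = Ỹ + gaugeDir W ζ = Ỹ′ + gaugeDir W ζ′` pointwise with `Ỹ, Ỹ′ ∈ 𝒯_E(W)`, `ζ, ζ′` skew
`(tower)`-periodic and `bmeanIterW L (j+1) W ζ = bmeanIterW L (j+1) W ζ′`, then `Ỹ = Ỹ′` and `gaugeDir W ζ = gaugeDir W ζ′` at every bond.  [`ξ := ζ′ − ζ ∈ Ξ_Q(W)`,
`Ỹ − Ỹ′ = gaugeDir W ξ` is orthogonal to `gaugeDir W ξ`, hence zero on the period box, hence everywhere.] [folklore] -/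
theorem slice_split_unique {L N : ℕ} [NeZero L] [NeZero N] (j : ℕ) {W : Site d → Fin d → (Matrix n n ℂ)ˣ}
    (hWP : IsPeriodicCfg W ((tower L N (j + 1) : ℕ) : ℤ))
    {T Yt Yt' : Site d → Fin d → Matrix n n ℂ} {ζ ζ' : Site d → Matrix n n ℂ}
    (hYt : Yt ∈ energyBlockLandauW (d := d) (n := n) L N (j + 1) W) (hYt' : Yt' ∈ energyBlockLandauW (d := d) (n := n) L N (j + 1) W)
    (hζs : ∀ y, ζ y ∈ skewAdjoint (Matrix n n ℂ)) (hζP : ∀ (y : Site d) (i : Fin d), ζ (y + ((tower L N (j + 1) : ℕ) : ℤ) • e i) = ζ y)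
    (hζ's : ∀ y, ζ' y ∈ skewAdjoint (Matrix n n ℂ)) (hζ'P : ∀ (y : Site d) (i : Fin d), ζ' (y + ((tower L N (j + 1) : ℕ) : ℤ) • e i) = ζ' y)
    (hsplit : ∀ y μ, T y μ = Yt y μ + gaugeDir W ζ y μ) (hsplit' : ∀ y μ, T y μ = Yt' y μ + gaugeDir W ζ' y μ)
    (hmean : bmeanIterW L (j + 1) W ζ = bmeanIterW L (j + 1) W ζ') :
    (∀ y μ, Yt y μ = Yt' y μ) ∧ ∀ y μ, gaugeDir W ζ y μ = gaugeDir W ζ' y μ := by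
  have hP1 : 1 ≤ tower L N (j + 1) := Nat.one_le_iff_ne_zero.mpr (NeZero.ne _)
  set ξ : Site d → Matrix n n ℂ := fun y => ζ' y - ζ y with hξ
  have hξP : ∀ (y : Site d) (i : Fin d), ξ (y + ((tower L N (j + 1) : ℕ) : ℤ) • e i) = ξ y := fun y i => by
    simp only [hξ, hζP y i, hζ'P y i]
  have hξmem : ξ ∈ meanZeroGaugeSpaceW (d := d) (n := n) L (j + 1) W (tower L N (j + 1)) := by
    refine mem_meanZeroGaugeSpaceW_iff.mpr ⟨⟨hξP, fun y => (skewAdjoint _).sub_mem (hζ's y) (hζs y)⟩, ?_⟩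
    rw [hξ, bmeanIterW_sub, ← hmean]
    funext z; simp
  -- `Ỹ − Ỹ′ = gaugeDir W ξ`
  have hdiff : ∀ y μ, Yt y μ - Yt' y μ = gaugeDir W ξ y μ := fun y μ => by
    have e1 : Yt y μ = T y μ - gaugeDir W ζ y μ := by rw [hsplit y μ]; abel
    have e2 : Yt' y μ = T y μ - gaugeDir W ζ' y μ := by rw [hsplit' y μ]; abel
    rw [e1, e2, hξ, ← gaugeDir_sub_fun]
    abel
  -- orthogonality of both slice parts against `gaugeDir W ξ`, subtracted
  have horth : ∑ y ∈ periodBox (d := d) (tower L N (j + 1)), ∑ κ : Fin d, hsR (gaugeDir W ξ y κ) (gaugeDir W ξ y κ) = 0 := by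
    have h1 := hYt.2.2.2 ξ hξmem
    have h2 := hYt'.2.2.2 ξ hξmem
    have h3 : ∑ y ∈ periodBox (d := d) (tower L N (j + 1)), ∑ κ : Fin d, hsR (Yt y κ - Yt' y κ) (gaugeDir W ξ y κ) = 0 := by
      simp_rw [hsR_sub_left, Finset.sum_sub_distrib, h1, h2, sub_zero]
    simpa only [hdiff] using h3
  simp_rw [hsR_self] at horth
  have hzero : ∀ y ∈ periodBox (d := d) (tower L N (j + 1)), ∀ κ : Fin d, gaugeDir W ξ y κ = 0 := by
    intro y hy κ
    have hy0 := (Finset.sum_eq_zero_iff_of_nonneg fun z _ => Finset.sum_nonneg fun κ _ => nhsNormSq_nonneg (gaugeDir W ξ z κ)).1 horth y hy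
    exact eq_zero_of_nhsNormSq_eq_zero ((Finset.sum_eq_zero_iff_of_nonneg fun κ _ => nhsNormSq_nonneg (gaugeDir W ξ y κ)).1 hy0 κ (Finset.mem_univ _))
  -- everywhere by periodicity
  have hGP : IsPeriodicDir (gaugeDir W ξ) ((tower L N (j + 1) : ℕ) : ℤ) := isPeriodicDir_gaugeDir hWP hξP
  have hall : ∀ y κ, gaugeDir W ξ y κ = 0 := fun y κ => by
    have hw := apply_wrap_eq (g := fun w => gaugeDir W ξ w κ) (fun z i => hGP z i κ) y
    rw [← hw]
    exact hzero _ (wrap_mem_periodBox _ hP1 y) κ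
  have hG : ∀ y μ, gaugeDir W ζ y μ = gaugeDir W ζ' y μ := fun y μ => by
    have h := hall y μ
    rw [hξ, ← gaugeDir_sub_fun] at h
    exact (sub_eq_zero.mp h).symm
  refine ⟨fun y μ => ?_, hG⟩
  have h := hdiff y μ
  rw [hall y μ] at h
  exact sub_eq_zero.mp h

/-! ## §3 Additivity; a slice element splits trivially -/

/-- **THE SPLIT IS ADDITIVE** (multi-level small-field class, `W` unitary `(tower)`-periodic): given splits `T₁ = Ỹ₁ + gaugeDir W ζ₁`, `T₂ = Ỹ₂ + gaugeDir W ζ₂` and a split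
`T₁ + T₂ = Ỹ + gaugeDir W ζ` (all slice parts in `𝒯_E(W)`, all gauge functions skew periodic) with `bmeanIterW ζ = bmeanIterW ζ₁ + bmeanIterW ζ₂`, one has `Ỹ = Ỹ₁ + Ỹ₂` and
`gaugeDir W ζ = gaugeDir W ζ₁ + gaugeDir W ζ₂` pointwise. [folklore] -/
theorem slice_split_add [Nonempty n] {L N : ℕ} [NeZero L] [NeZero N] (hL : 1 ≤ L) (j : ℕ) {W : Site d → Fin d → (Matrix n n ℂ)ˣ} {x : ℝ}
    (hWu : IsUnitaryCfg W) (hWP : IsPeriodicCfg W ((tower L N (j + 1) : ℕ) : ℤ)) (hx : 0 ≤ x) (hs : LevelSmall d L j x) (hWx : SmallField W x)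
    {T₁ T₂ Y₁ Y₂ Yt : Site d → Fin d → Matrix n n ℂ} {ζ₁ ζ₂ ζ : Site d → Matrix n n ℂ}
    (hY₁ : Y₁ ∈ energyBlockLandauW (d := d) (n := n) L N (j + 1) W) (hY₂ : Y₂ ∈ energyBlockLandauW (d := d) (n := n) L N (j + 1) W)
    (hYt : Yt ∈ energyBlockLandauW (d := d) (n := n) L N (j + 1) W)
    (hζ₁s : ∀ y, ζ₁ y ∈ skewAdjoint (Matrix n n ℂ)) (hζ₁P : ∀ (y : Site d) (i : Fin d), ζ₁ (y + ((tower L N (j + 1) : ℕ) : ℤ) • e i) = ζ₁ y)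
    (hζ₂s : ∀ y, ζ₂ y ∈ skewAdjoint (Matrix n n ℂ)) (hζ₂P : ∀ (y : Site d) (i : Fin d), ζ₂ (y + ((tower L N (j + 1) : ℕ) : ℤ) • e i) = ζ₂ y)
    (hζs : ∀ y, ζ y ∈ skewAdjoint (Matrix n n ℂ)) (hζP : ∀ (y : Site d) (i : Fin d), ζ (y + ((tower L N (j + 1) : ℕ) : ℤ) • e i) = ζ y)
    (h₁ : ∀ y μ, T₁ y μ = Y₁ y μ + gaugeDir W ζ₁ y μ) (h₂ : ∀ y μ, T₂ y μ = Y₂ y μ + gaugeDir W ζ₂ y μ)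
    (h : ∀ y μ, T₁ y μ + T₂ y μ = Yt y μ + gaugeDir W ζ y μ)
    (hmean : ∀ z, bmeanIterW L (j + 1) W ζ z = bmeanIterW L (j + 1) W ζ₁ z + bmeanIterW L (j + 1) W ζ₂ z) :
    (∀ y μ, Yt y μ = Y₁ y μ + Y₂ y μ) ∧ ∀ y μ, gaugeDir W ζ y μ = gaugeDir W ζ₁ y μ + gaugeDir W ζ₂ y μ := by
  have hsum := mem_energyBlockLandauW_add hL j hWu hx hs hWx hY₁ hY₂
  have hsplit' : ∀ y μ, T₁ y μ + T₂ y μ = (fun y μ => Y₁ y μ + Y₂ y μ) y μ + gaugeDir W (fun w => ζ₁ w + ζ₂ w) y μ := fun y μ => by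
    simp only [gaugeDir_add_fun, h₁ y μ, h₂ y μ]; abel
  have hmean' : bmeanIterW L (j + 1) W ζ = bmeanIterW L (j + 1) W (fun w => ζ₁ w + ζ₂ w) := by
    have e : (fun w => ζ₁ w + ζ₂ w) = ζ₁ + ζ₂ := rfl
    rw [e, bmeanIterW_add]
    funext z; exact hmean z
  obtain ⟨hY, hG⟩ := slice_split_unique (T := fun y μ => T₁ y μ + T₂ y μ) j hWP hYt hsum hζs hζP
    (fun y => (skewAdjoint _).add_mem (hζ₁s y) (hζ₂s y)) (fun y i => by simp only [hζ₁P y i, hζ₂P y i]) h hsplit' hmean'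
  exact ⟨hY, fun y μ => by rw [hG y μ, gaugeDir_add_fun]⟩

/-- **A SLICE ELEMENT SPLITS TRIVIALLY**: `Ỹ ∈ 𝒯_E(W)`, `Ỹ = Y′ + gaugeDir W ζ` with `Y′ ∈ 𝒯_E(W)`, `ζ` skew periodic with `bmeanIterW ζ = 0` ⟹ `Y′ = Ỹ` and `gaugeDir W ζ = 0`. [folklore] -/
theorem slice_split_of_mem {L N : ℕ} [NeZero L] [NeZero N] (j : ℕ) {W : Site d → Fin d → (Matrix n n ℂ)ˣ}
    (hWP : IsPeriodicCfg W ((tower L N (j + 1) : ℕ) : ℤ))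
    {Yt Y' : Site d → Fin d → Matrix n n ℂ} {ζ : Site d → Matrix n n ℂ}
    (hYt : Yt ∈ energyBlockLandauW (d := d) (n := n) L N (j + 1) W) (hY' : Y' ∈ energyBlockLandauW (d := d) (n := n) L N (j + 1) W)
    (hζs : ∀ y, ζ y ∈ skewAdjoint (Matrix n n ℂ)) (hζP : ∀ (y : Site d) (i : Fin d), ζ (y + ((tower L N (j + 1) : ℕ) : ℤ) • e i) = ζ y)
    (hsplit : ∀ y μ, Yt y μ = Y' y μ + gaugeDir W ζ y μ) (hmean : bmeanIterW L (j + 1) W ζ = 0) :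
    (∀ y μ, Y' y μ = Yt y μ) ∧ ∀ y μ, gaugeDir W ζ y μ = 0 := by
  have htriv : ∀ y μ, Yt y μ = Yt y μ + gaugeDir W (fun _ => (0 : Matrix n n ℂ)) y μ := fun y μ => by
    rw [gaugeDir_zero_fun]; simp
  have hmean' : bmeanIterW L (j + 1) W ζ = bmeanIterW L (j + 1) W (fun _ => (0 : Matrix n n ℂ)) := by
    rw [hmean]; exact (bmeanIterW_zero' L (j + 1) W).symm
  obtain ⟨hY, hG⟩ := slice_split_unique (T := Yt) j hWP hY' hYt hζs hζP (fun _ => (skewAdjoint _).zero_mem) (fun _ _ => rfl) hsplit htriv hmean'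
  refine ⟨hY, fun y μ => ?_⟩
  rw [hG y μ, gaugeDir_zero_fun]

end

end Summit.QuantumFields.BalabanUV.T4Continuum.NE7SliceSplitUnique
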